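import Literature.NumberTheory.Automorphic.InfinityTypeAutomorphicInduction
import Literature.NumberTheory.Automorphic.BaseChangeArchimedean
import HarnessLib

/-!
# SoloBlindResolventType — the infinity type of `AI_{M/L} ∘ BC_{M/K}` across a compositum square

Solo seat `solo-Langlands-blind` (blind mode), session 4.  Setting ("resolvent square"): number
fields `F ⊆ K ⊆ M` and `F ⊆ L ⊆ M` with `M` the compositum of `K` and `L`, linearly disjoint over
`F` — the case in point is `K` a complex cubic field, `F = ℚ`, `M = K̃` its `S₃`-closure and `L` the
imaginary quadratic resolvent field.  For a cuspidal `π` on `GL_n/K` with infinity type `T`, the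
representation `Θ = AI_{M/L}(BC_{M/K} π)` of `GL_N/L` (`N = n [K:F]`) has infinity type
`(T^{M})^{M/L}` (`InfinityType.baseChange` then `InfinityType.automorphicInduction`).  The theorem
of this file identifies it with the base change to `L` of the *virtual* induced type `T^{K/F}`:

  `(T.baseChange M).automorphicInduction L N τ = (T.automorphicInduction F N) (τ|_F)`,

i.e. at an embedding `τ` of `L`, `Θ` has the infinity type that `AI_{K/F}(π)` would have at
`τ|_F` — although `AI_{K/F}` itself is not available when `K/F` is not normal.  This is the
archimedean bookkeeping behind the seat's "dihedral door" (paper/dihedral-door.md, Prop. 3.3):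
weak regularity / irregularity of `Θ` is read off the weights of `π` over each real place of `F`.

The field-theoretic input is isolated as two hypotheses on complex embeddings, both of which hold
for a linearly disjoint compositum: (`hdet`) an embedding of `M` is determined by its restrictions
to `K` and to `L`; (`hcard`) over every embedding `τ` of `L` there are as many embeddings of `M` as
there are embeddings of `K` over `τ|_F`.

* `restrict_mem_fiber` — restriction to `K` maps the embeddings of `M` over `τ` into the
  embeddings of `K` over `τ|_F` (scalar-tower bookkeeping).
* `automorphicInduction_baseChange_eq` — the displayed identity, by reindexing the fibre sum
  along the bijection "restrict to `K`".
* `count_automorphicInduction_baseChange_eq` — consequently every `z`-exponent has the same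
  multiplicity in `Θ`'s type at `τ` as in `T^{K/F}` at `τ|_F` (so "all multiplicities `≤ 2`",
  Fakhruddin–Pilloni's *weakly regular*, and "some multiplicity `≥ 2`", irregularity, transfer).
* `embedding_ext_of_adjoin_eq_top`, `card_filter_comp_algebraMap_eq` — the two hypotheses
  discharged: for `M` generated over `K` by `L` (`Algebra.adjoin K (range (algebraMap L M)) = ⊤`)
  embeddings are determined by their restrictions (`AlgHom.ext_of_adjoin_eq_top`), and the fibre
  over `τ` has `[M : L]` elements (`AlgHom.card`).
* `automorphicInduction_baseChange_eq_of_compositum` — the number-field statement with the honest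
  hypotheses `M = K·L` and `[M : L] = [K : F]`, and its regularity corollary.
-/

open scoped Classical
open NumberField Literature.NumberTheory.Automorphic

namespace Summit.Langlands.Langlands.Theorems
namespace SoloBlind

section ResolventSquare

variable {F K L M : Type*} [Field F] [Field K] [Field L] [Field M]
  [Algebra F K] [Algebra F L] [Algebra K M] [Algebra L M] [Algebra F M]
  [IsScalarTower F K M] [IsScalarTower F L M]
  [Fintype (K →+* ℂ)] [Fintype (M →+* ℂ)] {n N : ℕ}

omit [Fintype (K →+* ℂ)] [Fintype (M →+* ℂ)] in
/-- Restricting an embedding of `M` lying over `τ : L →+* ℂ` to `K` gives an embedding of `K`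
lying over `τ|_F` (both equal `σ̃|_F` by the scalar towers). -/
theorem restrict_mem_fiber (τ : L →+* ℂ) (σ' : M →+* ℂ)
    (hσ' : σ'.comp (algebraMap L M) = τ) :
    (σ'.comp (algebraMap K M)).comp (algebraMap F K) = τ.comp (algebraMap F L) := by
  rw [RingHom.comp_assoc, ← IsScalarTower.algebraMap_eq F K M, IsScalarTower.algebraMap_eq F L M,
    ← RingHom.comp_assoc, hσ']

/-- **Infinity type of `AI_{M/L} ∘ BC_{M/K}` across a resolvent square.**  If embeddings of `M` are
determined by their restrictions to `K` and `L` (`hdet`) and the fibre of embeddings of `M` over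
`τ` has the same size as the fibre of embeddings of `K` over `τ|_F` (`hcard`) — both automatic when
`M = K·L` is a compositum linearly disjoint over `F` — then
`(T^{M})^{M/L}(τ) = T^{K/F}(τ|_F)`. -/
theorem automorphicInduction_baseChange_eq
    (hdet : ∀ σ₁ σ₂ : M →+* ℂ, σ₁.comp (algebraMap K M) = σ₂.comp (algebraMap K M) →
      σ₁.comp (algebraMap L M) = σ₂.comp (algebraMap L M) → σ₁ = σ₂)
    (τ : L →+* ℂ)
    (hcard : (Finset.univ.filter (fun σ' : M →+* ℂ => σ'.comp (algebraMap L M) = τ)).card =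
      (Finset.univ.filter (fun σ : K →+* ℂ =>
        σ.comp (algebraMap F K) = τ.comp (algebraMap F L))).card)
    (T : InfinityType K n) :
    (T.baseChange M).automorphicInduction L N τ =
      T.automorphicInduction F N (τ.comp (algebraMap F L)) := by
  rw [InfinityType.automorphicInduction_apply, InfinityType.automorphicInduction_apply]
  simp only [InfinityType.baseChange_apply]
  -- reindex the left sum along `σ' ↦ σ'|_K`, a bijection between the two fibres
  set A := Finset.univ.filter (fun σ' : M →+* ℂ => σ'.comp (algebraMap L M) = τ) with hA
  set B := Finset.univ.filter (fun σ : K →+* ℂ =>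
    σ.comp (algebraMap F K) = τ.comp (algebraMap F L)) with hB
  have hmaps : ∀ σ' ∈ A, σ'.comp (algebraMap K M) ∈ B := by
    intro σ' hσ'
    rw [hA, Finset.mem_filter] at hσ'
    rw [hB, Finset.mem_filter]
    exact ⟨Finset.mem_univ _, restrict_mem_fiber τ σ' hσ'.2⟩
  have hinj : Set.InjOn (fun σ' : M →+* ℂ => σ'.comp (algebraMap K M)) A := by
    intro σ₁ h₁ σ₂ h₂ h
    rw [hA, Finset.coe_filter] at h₁ h₂
    exact hdet σ₁ σ₂ h (h₁.2.trans h₂.2.symm)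
  have himage : A.image (fun σ' : M →+* ℂ => σ'.comp (algebraMap K M)) = B := by
    apply Finset.eq_of_subset_of_card_le
    · intro σ hσ
      obtain ⟨σ', hσ', rfl⟩ := Finset.mem_image.mp hσ
      exact hmaps σ' hσ'
    · rw [Finset.card_image_of_injOn hinj, ← hcard]
  rw [← himage, Finset.sum_image hinj]

/-- **Multiplicities transfer.**  Under the same hypotheses, every `z`-exponent `x` occurs in the
infinity type of `AI_{M/L}(BC_{M/K} π)` at `τ` exactly as often as in the virtual induced type
`T^{K/F}` at `τ|_F`; in particular "all multiplicities `≤ 2`" (weakly regular at `τ`) and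
"some exponent repeated" (not regular at `τ`) are read off the weights of `π` above `τ|_F`. -/
theorem count_automorphicInduction_baseChange_eq
    (hdet : ∀ σ₁ σ₂ : M →+* ℂ, σ₁.comp (algebraMap K M) = σ₂.comp (algebraMap K M) →
      σ₁.comp (algebraMap L M) = σ₂.comp (algebraMap L M) → σ₁ = σ₂)
    (τ : L →+* ℂ)
    (hcard : (Finset.univ.filter (fun σ' : M →+* ℂ => σ'.comp (algebraMap L M) = τ)).card =
      (Finset.univ.filter (fun σ : K →+* ℂ =>
        σ.comp (algebraMap F K) = τ.comp (algebraMap F L))).card)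
    (T : InfinityType K n) (x : ℂ) :
    Multiset.count x (((T.baseChange M).automorphicInduction L N τ).map ArchWeight.a) =
      Multiset.count x ((T.automorphicInduction F N (τ.comp (algebraMap F L))).map ArchWeight.a) := by
  rw [automorphicInduction_baseChange_eq hdet τ hcard T]

/-- **Regularity transfers both ways across the square**: `(T^M)^{M/L}` is regular at `τ` iff
`T^{K/F}` is regular at `τ|_F`.  (With `SoloBlindStrongPurity`: when `K` has a complex place above
the real place `τ|_F`, the right-hand side fails for every infinity type of a cuspidal `π`, so
`Θ = AI_{M/L}(BC_{M/K} π)` is never regular — but it may be *weakly* regular.) -/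
theorem nodup_automorphicInduction_baseChange_iff
    (hdet : ∀ σ₁ σ₂ : M →+* ℂ, σ₁.comp (algebraMap K M) = σ₂.comp (algebraMap K M) →
      σ₁.comp (algebraMap L M) = σ₂.comp (algebraMap L M) → σ₁ = σ₂)
    (τ : L →+* ℂ)
    (hcard : (Finset.univ.filter (fun σ' : M →+* ℂ => σ'.comp (algebraMap L M) = τ)).card =
      (Finset.univ.filter (fun σ : K →+* ℂ =>
        σ.comp (algebraMap F K) = τ.comp (algebraMap F L))).card)
    (T : InfinityType K n) :
    (((T.baseChange M).automorphicInduction L N τ).map ArchWeight.a).Nodup ↔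
      ((T.automorphicInduction F N (τ.comp (algebraMap F L))).map ArchWeight.a).Nodup := by
  rw [automorphicInduction_baseChange_eq hdet τ hcard T]

omit [Algebra F K] [Algebra F L] [Algebra F M] [IsScalarTower F K M] [IsScalarTower F L M]
  [Fintype (K →+* ℂ)] [Fintype (M →+* ℂ)] in
/-- **(`hdet`) for a compositum.**  If `M` is generated over `K` by (the image of) `L`, an
embedding of `M` into `ℂ` is determined by its restrictions to `K` and to `L`. -/
theorem embedding_ext_of_adjoin_eq_top
    (hgen : Algebra.adjoin K (Set.range (algebraMap L M)) = ⊤)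
    (σ₁ σ₂ : M →+* ℂ) (hK : σ₁.comp (algebraMap K M) = σ₂.comp (algebraMap K M))
    (hL : σ₁.comp (algebraMap L M) = σ₂.comp (algebraMap L M)) : σ₁ = σ₂ := by
  letI : Algebra K ℂ := (σ₁.comp (algebraMap K M)).toAlgebra
  let φ₁ : M →ₐ[K] ℂ := { σ₁ with commutes' := fun r => rfl }
  let φ₂ : M →ₐ[K] ℂ :=
    { σ₂ with commutes' := fun r => (RingHom.congr_fun hK r).symm }
  have h : φ₁ = φ₂ := AlgHom.ext_of_adjoin_eq_top hgen fun x hx => by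
    obtain ⟨y, rfl⟩ := hx
    exact RingHom.congr_fun hL y
  exact RingHom.ext fun x => by simpa [φ₁, φ₂] using AlgHom.congr_fun h x

omit [Algebra F K] [Algebra F L] [Algebra K M] [Algebra F M] [IsScalarTower F K M]
  [IsScalarTower F L M] [Fintype (K →+* ℂ)] in
/-- **Fibre count.**  Over an embedding `τ : L →+* ℂ` there are exactly `[M : L]` embeddings of
`M` (`M/L` a finite extension of fields of characteristic zero; Mathlib's `AlgHom.card` for the
`L`-algebra structure on `ℂ` given by `τ`). -/
theorem card_filter_comp_algebraMap_eq [CharZero L] [FiniteDimensional L M] (τ : L →+* ℂ) :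
    (Finset.univ.filter (fun σ' : M →+* ℂ => σ'.comp (algebraMap L M) = τ)).card =
      Module.finrank L M := by
  letI : Algebra L ℂ := τ.toAlgebra
  let e : {σ' : M →+* ℂ // σ'.comp (algebraMap L M) = τ} ≃ (M →ₐ[L] ℂ) :=
    { toFun := fun σ' => { σ'.1 with commutes' := fun r => RingHom.congr_fun σ'.2 r }
      invFun := fun φ => ⟨φ.toRingHom, RingHom.ext fun r => φ.commutes r⟩
      left_inv := fun σ' => by ext; rfl
      right_inv := fun φ => by ext; rfl }
  rw [← Fintype.card_subtype, Fintype.card_congr e, AlgHom.card]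

end ResolventSquare

section NumberFields

variable {F K L M : Type} [Field F] [NumberField F] [Field K] [NumberField K]
  [Field L] [NumberField L] [Field M] [NumberField M]
  [Algebra F K] [Algebra F L] [Algebra K M] [Algebra L M] [Algebra F M]
  [IsScalarTower F K M] [IsScalarTower F L M] {n N : ℕ}

/-- **Resolvent transport of infinity types (number fields).**  Let `F ⊆ K ⊆ M ⊇ L ⊇ F` be number
fields with `M = K·L` (`M` is generated over `K` by `L`) and `[M : L] = [K : F]` (linear
disjointness) — e.g. `K` a complex cubic field, `M` its `S₃`-closure, `L` the quadratic resolvent,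
`F = ℚ`.  Then for every infinity type `T` on `GL_n/K` and every embedding `τ` of `L`, the infinity
type of `AI_{M/L}(BC_{M/K} ·)` at `τ` is the virtual induced type `T^{K/F}` at `τ|_F`:
`(T^M)^{M/L}(τ) = T^{K/F}(τ|_F)`.  In particular its `z`-exponent multiplicities (regularity, weak
regularity) are those of the weights of `T` at the embeddings of `K` above `τ|_F`. -/
theorem automorphicInduction_baseChange_eq_of_compositum
    (hgen : Algebra.adjoin K (Set.range (algebraMap L M)) = ⊤)
    (hrank : Module.finrank L M = Module.finrank F K)
    (T : InfinityType K n) (τ : L →+* ℂ) :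
    (T.baseChange M).automorphicInduction L N τ =
      T.automorphicInduction F N (τ.comp (algebraMap F L)) := by
  refine automorphicInduction_baseChange_eq (embedding_ext_of_adjoin_eq_top hgen) τ ?_ T
  rw [card_filter_comp_algebraMap_eq (L := L) (M := M) τ,
    card_filter_comp_algebraMap_eq (L := F) (M := K) (τ.comp (algebraMap F L)), hrank]

/-- Corollary: regularity of `Θ = AI_{M/L}(BC_{M/K} π)` at `τ` is regularity of the virtual
`AI_{K/F}`-type at `τ|_F` — which fails as soon as two embeddings of `K` over `τ|_F` carry the
same `z`-exponents (`SoloBlindStrongPurity.not_isRegular_automorphicInduction_of_two_embeddings`),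
e.g. at the complex place of a complex cubic field. -/
theorem isRegular_automorphicInduction_baseChange_iff_of_compositum
    (hgen : Algebra.adjoin K (Set.range (algebraMap L M)) = ⊤)
    (hrank : Module.finrank L M = Module.finrank F K) (T : InfinityType K n) :
    ((T.baseChange M).automorphicInduction L N).IsRegular ↔
      ∀ τ : L →+* ℂ,
        ((T.automorphicInduction F N (τ.comp (algebraMap F L))).map ArchWeight.a).Nodup := by
  refine forall_congr' fun τ => ?_
  rw [automorphicInduction_baseChange_eq_of_compositum hgen hrank T τ]

end NumberFields

end SoloBlind
end Summit.Langlands.Langlands.Theorems
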